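import Literature.Probability.RandomPlanarGeometry.SLE
import Literature.Probability.RandomPlanarGeometry.ChordalCurveFamily
import HarnessLib

/-!
# Topological copies of chordal SLE_κ laws

Topic `Literature/Probability/RandomPlanarGeometry`; definition item
`defn-ChordalFamily.IsTopologicalSLEAt` for route `CriticalPhenomena/SAWRestrictionDescent`
(items `stmt-CriticalPhenomena-8478` `TopTriv`, conclusion, and `8479` `TopRes`, hypothesis).

For a chordal curve family `P : DobrushinDomain → Measure (CurveClass ℂ)` (`ChordalFamily`), a
parameter `κ : ℝ≥0` and a Dobrushin domain `(D; a, b)` (`a = D.pt 0`, `b = D.pt 1`),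
**`P.IsTopologicalSLEAt κ D`** says: *`P D` is a topological copy of the chordal SLE_κ law of the
same marked domain* — there are a continuous `F : ℂ → ℂ`, injective on `closure D` with
`F(D) = D`, `F(a) = a`, `F(b) = b` (a self-homeomorphism of the CLOSED domain fixing the marks; by
Tietze any such map extends continuously to `ℂ`, so quantifying over `C(ℂ, ℂ)` loses nothing and
no Schoenflies theorem is needed), and a chordal SLE_κ law `μ` in `(D; a, b)` (`IsSLELaw κ D μ`,
file `SLE.lean`) with `P D = (CurveClass.map F)_* μ`. The body is VERBATIM the clause inlined in
the two items (with `8/3` generalised to `κ`), so they restate by `Iff.rfl`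
(`ChordalFamily.isTopologicalSLEAt_iff`).

API: `isTopologicalSLEAt_iff` (`Iff.rfl`); the sanity lemma
`ChordalFamily.isTopologicalSLEAt_of_isSLELaw` — an SLE_κ law is a topological copy of itself
(`F = id`, `μ = P D`; uses `CurveClass.map id = id` and `Measure.map_id`); and the introduction
rule `ChordalFamily.isTopologicalSLEAt_of_eq_map`.

Background (why the notion is the right hinge for the route): conformal restriction / locality
characterisations identify SLE_{8/3} and SLE₆ among laws with given symmetries
(Lawler–Schramm–Werner 2003, *Conformal restriction: the chordal case*, JAMS 16, §8, for
`κ = 8/3`), and the route's descent theorem `TopRes` upgrades a TOPOLOGICAL copy with the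
restriction–Markov symmetries to the law itself; nothing of this is asserted here.
-/

noncomputable section

open MeasureTheory Set
open scoped NNReal

namespace Literature.Probability.RandomPlanarGeometry

/-- **`P D` is a topological copy of chordal SLE_κ in `(D; a, b)`**: some continuous `F : ℂ → ℂ`,
injective on `closure D.carrier`, with `F '' D.carrier = D.carrier`, `F (D.pt 0) = D.pt 0`,
`F (D.pt 1) = D.pt 1`, and some chordal SLE_κ law `μ` in `D` (`IsSLELaw κ D μ`) satisfy
`P D = μ.map (CurveClass.map F)`. Verbatim the clause of items `stmt-CriticalPhenomena-8478/8479`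
(route `SAWRestrictionDescent`), with `κ` in place of `8/3`. [folklore] -/
def ChordalFamily.IsTopologicalSLEAt (κ : ℝ≥0) (P : ChordalFamily) (D : DobrushinDomain) : Prop :=
  ∃ (F : C(ℂ, ℂ)) (μ : Measure (CurveClass ℂ)), Set.InjOn F (closure D.carrier) ∧
    F '' D.carrier = D.carrier ∧ F (D.pt 0) = D.pt 0 ∧ F (D.pt 1) = D.pt 1 ∧
    IsSLELaw κ D μ ∧ P D = μ.map (CurveClass.map F)

variable {κ : ℝ≥0} {P : ChordalFamily} {D : DobrushinDomain}

/-- Unfolding lemma (definitional). [folklore] -/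
theorem ChordalFamily.isTopologicalSLEAt_iff :
    P.IsTopologicalSLEAt κ D ↔
      ∃ (F : C(ℂ, ℂ)) (μ : Measure (CurveClass ℂ)), Set.InjOn F (closure D.carrier) ∧
        F '' D.carrier = D.carrier ∧ F (D.pt 0) = D.pt 0 ∧ F (D.pt 1) = D.pt 1 ∧
        IsSLELaw κ D μ ∧ P D = μ.map (CurveClass.map F) :=
  Iff.rfl

/-- Introduction rule: a law that is the push-forward of an SLE_κ law of `D` along a continuous
`F`, injective on `closure D`, preserving `D` and its two marks, is a topological copy of SLE_κ.
[folklore] -/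
theorem ChordalFamily.isTopologicalSLEAt_of_eq_map {F : C(ℂ, ℂ)} {μ : Measure (CurveClass ℂ)}
    (hinj : Set.InjOn F (closure D.carrier)) (himage : F '' D.carrier = D.carrier)
    (h0 : F (D.pt 0) = D.pt 0) (h1 : F (D.pt 1) = D.pt 1) (hμ : IsSLELaw κ D μ)
    (hP : P D = μ.map (CurveClass.map F)) : P.IsTopologicalSLEAt κ D :=
  ⟨F, μ, hinj, himage, h0, h1, hμ, hP⟩

/-- **Sanity: an SLE_κ law is a topological copy of itself** (`F = id`, `μ = P D`). [folklore] -/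
theorem ChordalFamily.isTopologicalSLEAt_of_isSLELaw (h : IsSLELaw κ D (P D)) :
    P.IsTopologicalSLEAt κ D := by
  have hid : CurveClass.map (ContinuousMap.id ℂ) = id := funext fun c => by
    obtain ⟨γ, rfl⟩ := CurveClass.surjective_mk c
    rfl
  refine ⟨ContinuousMap.id ℂ, P D, Set.injOn_id _, ?_, rfl, rfl, h, ?_⟩
  · simp
  · rw [hid, Measure.map_id]

end Literature.Probability.RandomPlanarGeometry
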